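import Summits.QuantumFields.BalabanUV.T4Continuum.Support.VariationalVectorEffective

/-!
# T⁴ programme, spine node NE2 (U1a), lane P2 — SUPPLIER ITEM «D-E»: LEAF D FOR E-VALUED CARRIERS — the effective operator and the η-rate
# currency of a block-spin species whose fields take values in a finite-dimensional complex Hilbert space `E` (colour ∕ vector sectors),
# by ORTHONORMAL-BASIS FLATTENING onto the lineage's matrix kernel `VariationalEffectiveOperator` (p212539)

NE2 formalisation swarm `b2b-balaban-t4-ne2-formalise-*`, leaf prover 02 (gen 4), lineage leaf-02 (s1 «D + KER»); journal INTENT «D-E» (CLAIMS.log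
2026-08-20T13:58Z).  The retired road owner's V-D note (l.11488) asks for «leaf D for E-valued forms», and `VariationalVectorEffective.towerLimitRate_effV`
(p216485) is stated at `E = ℂ` only (XREAD C-ne2leaf02g4-3 INFO-1).  THIS FILE is the E-valued leaf D, ABSTRACTLY — every colour ∕ vector instance is
then a naming exercise (sequel `VariationalEffectiveHilbertPairs`):
 * §1 the FLATTENING by an orthonormal basis `b : OrthonormalBasis κ ℂ E`: `flatE b φ (i, k) := ⟪b k, φ i⟫`, inverse `unflatE b w i := Σ_k w(i,k) • b k`
   (`unflatE_flatE` = `b.sum_repr'`, `flatE_unflatE` = orthonormality), the equivalence `flatEquivE`, ℂ-linearity, and PARSEVAL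
   **`nsq_flatE : nsq (flatE b φ) = Σ_i ‖φ i‖²`** (`OrthonormalBasis.sum_sq_norm_inner_right`);
 * §2 ℂ-linear maps of E-valued fields as MATRICES on the product index: `matE b A := toMatrix′(flat ∘ A ∘ unflat)`,
   **`matE_mulVec_flatE : matE b A *ᵥ flatE b φ = flatE b (A φ)`**, surjectivity transfer, and the Gram identity `qform (Mᴴ M) w = nsq (M *ᵥ w)`
   (so every «sum of squared norms of a linear expression» is the form of a PSD matrix after flattening: `sum_norm_sq_eq_qform_gram`);
 * §3 **`blockSpin_eq_effE`**: a constrained quadratic minimisation on E-valued fields — ℂ-linear ONTO constraint `Q`, form `S = qform K ∘ flatE b` with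
   `K` PSD, and the coercivity `Σ‖φ‖² ≤ C₁·Σ‖Qφ‖² + C₂·S φ` (leaf P's shape; KER by `ker_of_coercive`) — has the HERMITIAN effective operator
   `effOp K (matE b Q) a` of p212539 on `ι′ × κ`: `blockSpin Q S ψ = re⟨flatE b ψ, X · flatE b ψ⟩` (via `blockSpin_relabel` p216485 + `blockSpin_eq_effOp`);
 * §4 **`oneStepAveragedLaw_effE` ∕ `towerLimitRate_effE`**: a TOWER of such problems onto a fixed unit index `ι∞ → E` whose consecutive block-spin
   values obey the two one-sided additive brackets with defects `e_k, e′_k` (resp. `≤ C·ρ^k`, `ρ < 1`) has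
   `OneStepAveragedLaw (fun _ ↦ 1) 1 (k ↦ X_k) (max e e′)` (resp. `TowerLimitRate (fun _ ↦ 1) 1 (k ↦ X_k) C ρ`) on `ι∞ × κ` — row NE2's currency for ANY
   E-valued block-spin species MODULO its per-level brackets (the colour canonical pair p215316, the vector pair p216339 at general `E`).

HONEST FRAMING (T4-DAG p. 1).  [folklore] finite-dimensional linear algebra over the lineage's kernel; model-agnostic (no transports, no averaging,
no action appear here); data `def`s `flatE`, `unflatE`, `flatEquivE`, `flatLinE`, `unflatLinE`, `matE` only, no `def … : Prop`, no `sorry`; axioms standard.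
Nothing of NE2 is proved by this file.  NE2 NOT proved; spine PROVED 0∕9; rung (B)+1 finite T⁴ — NOT infinite volume, NOT a mass gap, NOT Clay.
HONEST DEPENDENCY (cell, verbatim): continuum YM on T⁴ ⇐ BetaPertH ∧ nine spine estimates (0/9 proved); BetaPertH ⇐ (D1) ∧ (D4) ∧ CAP+tail; G-an2-4
gates asym, D1 and NE2/3/4.
-/

noncomputable section

namespace Summit.QuantumFields.BalabanUV.T4Continuum.VariationalEffectiveHilbert

open Finset
open scoped Matrix ComplexConjugate ComplexOrder Matrix.Norms.L2Operator BigOperators InnerProductSpace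
open Literature.MathematicalPhysics.QuantumFieldTheory.Balaban1983to89.B5Prop11Lower (nsq nsq_nonneg star_dotProduct_self)
open Literature.Analysis.Complex (qform qform_nonneg_of_posSemidef)
open Summit.QuantumFields.BalabanUV.T4Continuum.VariationalTransfer (blockSpin)
open Summit.QuantumFields.BalabanUV.T4Continuum.VariationalEffectiveOperator
  (effOp ker_of_coercive blockSpin_eq_effOp effOp_isHermitian oneStepAveragedLaw_effOp)
open Summit.QuantumFields.BalabanUV.T4Continuum.VariationalVectorEffective (blockSpin_relabel)
open Summit.QuantumFields.BalabanUV.T4Continuum.BalabanAveragedCoerciveFibre (star_dotProduct_conjTranspose_mulVec)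
open Summit.QuantumFields.BalabanUV.T4Continuum.CovariantAveragingTower
  (OneStepAveragedLaw TowerLimitRate towerLimitRate_of_oneStepAveragedLaw opNorm_one_le)

variable {E : Type*} [NormedAddCommGroup E] [InnerProductSpace ℂ E]

/-! ## §1 Flattening an `E`-valued field by an orthonormal basis of `E` -/

section Flat

variable {ι κ : Type*} [Fintype κ]

/-- the coordinates of an `E`-valued field in the orthonormal basis `b`: `flatE b φ (i, k) = ⟪b k, φ i⟫`. [folklore] -/
def flatE (b : OrthonormalBasis κ ℂ E) (φ : ι → E) : ι × κ → ℂ := fun p => ⟪b p.2, φ p.1⟫_ℂ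

/-- … and back: `unflatE b w i = Σ_k w(i,k) • b k`. [folklore] -/
def unflatE (b : OrthonormalBasis κ ℂ E) (w : ι × κ → ℂ) : ι → E := fun i => ∑ k, w (i, k) • b k

/-- `unflat ∘ flat = id` (the basis expansion `Σ_k ⟪b k, v⟫ • b k = v`). [folklore] -/
@[simp] theorem unflatE_flatE (b : OrthonormalBasis κ ℂ E) (φ : ι → E) : unflatE b (flatE b φ) = φ := by
  funext i
  exact b.sum_repr' (φ i)

/-- `flat ∘ unflat = id` (orthonormality). [folklore] -/
@[simp] theorem flatE_unflatE [DecidableEq κ] (b : OrthonormalBasis κ ℂ E) (w : ι × κ → ℂ) : flatE b (unflatE b w) = w := by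
  funext p
  obtain ⟨i, k⟩ := p
  simp only [flatE, unflatE, inner_sum, inner_smul_right]
  have h : ∀ k' : κ, ⟪b k, b k'⟫_ℂ = if k = k' then 1 else 0 := fun k' => orthonormal_iff_ite.mp b.orthonormal k k'
  simp_rw [h, mul_ite, mul_one, mul_zero]
  rw [Finset.sum_ite_eq univ k (fun k' => w (i, k'))]
  simp

/-- the flattening as an equivalence of carriers. [folklore] -/
def flatEquivE [DecidableEq κ] (b : OrthonormalBasis κ ℂ E) : (ι → E) ≃ (ι × κ → ℂ) :=
  ⟨flatE b, unflatE b, unflatE_flatE b, flatE_unflatE b⟩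

/-- `flatE` is additive. [folklore] -/
theorem flatE_add (b : OrthonormalBasis κ ℂ E) (φ ψ : ι → E) : flatE b (φ + ψ) = flatE b φ + flatE b ψ := by
  funext p; simp [flatE]

/-- `flatE` is ℂ-homogeneous. [folklore] -/
theorem flatE_smul (b : OrthonormalBasis κ ℂ E) (c : ℂ) (φ : ι → E) : flatE b (c • φ) = c • flatE b φ := by
  funext p; simp [flatE]

/-- the flattening as a ℂ-linear map. [folklore] -/
def flatLinE (b : OrthonormalBasis κ ℂ E) : (ι → E) →ₗ[ℂ] (ι × κ → ℂ) where
  toFun := flatE b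
  map_add' := flatE_add b
  map_smul' := flatE_smul b

/-- the inverse flattening as a ℂ-linear map. [folklore] -/
def unflatLinE (b : OrthonormalBasis κ ℂ E) : (ι × κ → ℂ) →ₗ[ℂ] (ι → E) where
  toFun := unflatE b
  map_add' w w' := by
    funext i
    simp only [unflatE, Pi.add_apply, add_smul, Finset.sum_add_distrib]
  map_smul' c w := by
    funext i
    simp only [unflatE, Pi.smul_apply, smul_eq_mul, RingHom.id_apply, Finset.smul_sum, smul_smul]

/-- **PARSEVAL**: `nsq (flatE b φ) = Σ_i ‖φ i‖²`. [folklore] -/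
theorem nsq_flatE [Fintype ι] (b : OrthonormalBasis κ ℂ E) (φ : ι → E) : nsq (flatE b φ) = ∑ i, ‖φ i‖ ^ 2 := by
  unfold nsq flatE
  rw [Fintype.sum_prod_type]
  exact Finset.sum_congr rfl fun i _ => b.sum_sq_norm_inner_right (φ i)

end Flat

/-! ## §2 Linear maps of `E`-valued fields as matrices on the product index; Gram forms -/

section Mat

variable {ι ι' κ : Type*} [Fintype ι] [Fintype ι'] [Fintype κ] [DecidableEq ι] [DecidableEq ι'] [DecidableEq κ]

/-- the MATRIX of a ℂ-linear map of `E`-valued fields on the flattened indices. [folklore] -/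
def matE (b : OrthonormalBasis κ ℂ E) (A : (ι → E) →ₗ[ℂ] (ι' → E)) : Matrix (ι' × κ) (ι × κ) ℂ :=
  LinearMap.toMatrix' (flatLinE b ∘ₗ A ∘ₗ unflatLinE b)

omit [Fintype ι'] [DecidableEq ι'] in
/-- `matE b A *ᵥ w = flatE b (A (unflatE b w))`. [folklore] -/
theorem matE_mulVec (b : OrthonormalBasis κ ℂ E) (A : (ι → E) →ₗ[ℂ] (ι' → E)) (w : ι × κ → ℂ) :
    matE b A *ᵥ w = flatE b (A (unflatE b w)) := by
  rw [matE, LinearMap.toMatrix'_mulVec]; rfl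

omit [Fintype ι'] [DecidableEq ι'] in
/-- **the matrix acts as the map**: `matE b A *ᵥ flatE b φ = flatE b (A φ)`. [folklore] -/
theorem matE_mulVec_flatE (b : OrthonormalBasis κ ℂ E) (A : (ι → E) →ₗ[ℂ] (ι' → E)) (φ : ι → E) :
    matE b A *ᵥ flatE b φ = flatE b (A φ) := by
  rw [matE_mulVec, unflatE_flatE]

omit [Fintype ι'] [DecidableEq ι'] in
/-- an ONTO linear map has an onto matrix. [folklore] -/
theorem mulVec_matE_surjective (b : OrthonormalBasis κ ℂ E) {A : (ι → E) →ₗ[ℂ] (ι' → E)} (hA : Function.Surjective A) :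
    Function.Surjective (matE b A).mulVec := by
  intro w'
  obtain ⟨φ, hφ⟩ := hA (unflatE b w')
  exact ⟨flatE b φ, by rw [matE_mulVec_flatE, hφ, flatE_unflatE]⟩

omit [DecidableEq ι] in
/-- the GRAM identity: `qform (Mᴴ·M) w = nsq (M *ᵥ w)`. [folklore] -/
theorem qform_gram {m : Type*} [Fintype m] (Mx : Matrix m ι ℂ) (w : ι → ℂ) : qform (Mxᴴ * Mx) w = nsq (Mx *ᵥ w) := by
  rw [qform, ← Matrix.mulVec_mulVec, star_dotProduct_conjTranspose_mulVec, star_dotProduct_self, Complex.ofReal_re]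

omit [DecidableEq ι'] in
/-- **sums of squared norms of a linear expression are Gram forms after flattening**: `Σ_{i′} ‖(A φ) i′‖² = qform ((matE b A)ᴴ·matE b A) (flatE b φ)`.
[folklore] -/
theorem sum_norm_sq_eq_qform_gram (b : OrthonormalBasis κ ℂ E) (A : (ι → E) →ₗ[ℂ] (ι' → E)) (φ : ι → E) :
    ∑ i', ‖A φ i'‖ ^ 2 = qform ((matE b A)ᴴ * matE b A) (flatE b φ) := by
  rw [qform_gram, matE_mulVec_flatE, nsq_flatE]

/-! ## §3 The effective operator of an `E`-valued constrained quadratic minimisation -/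

omit [Fintype ι'] [DecidableEq ι'] in
/-- the block-spin value is invariant under flattening: `blockSpin (matE b Q *ᵥ ·) S♭ (flatE b ψ) = blockSpin Q S ψ` when `S♭ ∘ flatE b = S`. [folklore] -/
theorem blockSpin_flatE (b : OrthonormalBasis κ ℂ E) (Q : (ι → E) →ₗ[ℂ] (ι' → E)) {S : (ι → E) → ℝ} {Sf : (ι × κ → ℂ) → ℝ}
    (hS : ∀ φ, Sf (flatE b φ) = S φ) (ψ : ι' → E) :
    blockSpin (matE b Q).mulVec Sf (flatE b ψ) = blockSpin Q S ψ :=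
  blockSpin_relabel (flatEquivE b) (flatEquivE b) (Q := Q) (Q' := (matE b Q).mulVec) (S := S) (S' := Sf)
    (fun φ => matE_mulVec_flatE b Q φ) hS ψ

omit [DecidableEq ι'] in
/-- coercivity in leaf P's shape transports to the flattened problem and gives KER. [folklore] -/
theorem ker_flatE (b : OrthonormalBasis κ ℂ E) (Q : (ι → E) →ₗ[ℂ] (ι' → E)) {K : Matrix (ι × κ) (ι × κ) ℂ} {S : (ι → E) → ℝ}
    (hS : ∀ φ, S φ = qform K (flatE b φ)) {C₁ C₂ : ℝ} (hcoer : ∀ φ : ι → E, ∑ i, ‖φ i‖ ^ 2 ≤ C₁ * ∑ i', ‖Q φ i'‖ ^ 2 + C₂ * S φ) :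
    ∀ w, qform K w = 0 → matE b Q *ᵥ w = 0 → w = 0 := by
  refine ker_of_coercive (C₁ := C₁) (C₂ := C₂) fun w => ?_
  have h := hcoer (unflatE b w)
  rw [hS, ← nsq_flatE b, ← nsq_flatE b, ← matE_mulVec_flatE, flatE_unflatE] at h
  exact h

/-- **THE E-VALUED EFFECTIVE OPERATOR**: for a ℂ-linear ONTO constraint `Q`, a form `S = qform K ∘ flatE b` with `K` PSD, and the coercivity
`Σ‖φ‖² ≤ C₁·Σ‖Qφ‖² + C₂·S φ`, the block-spin value is the Hermitian form of `X := effOp K (matE b Q) a` on the flattened unit index: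
`blockSpin Q S ψ = re⟨flatE b ψ, X · flatE b ψ⟩` (any `a > 0`; `X` does not depend on `a`, by `effOp_eq_effOp`; it depends on the basis `b` through a
unitary relabelling of `κ`-coordinates only). [folklore] -/
theorem blockSpin_eq_effE (b : OrthonormalBasis κ ℂ E) {Q : (ι → E) →ₗ[ℂ] (ι' → E)} (hQ : Function.Surjective Q)
    {K : Matrix (ι × κ) (ι × κ) ℂ} (hK : K.PosSemidef) {S : (ι → E) → ℝ} (hS : ∀ φ, S φ = qform K (flatE b φ)) {C₁ C₂ : ℝ}
    (hcoer : ∀ φ : ι → E, ∑ i, ‖φ i‖ ^ 2 ≤ C₁ * ∑ i', ‖Q φ i'‖ ^ 2 + C₂ * S φ) {a : ℝ} (ha : 0 < a) (ψ : ι' → E) :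
    blockSpin Q S ψ = (star (flatE b ψ) ⬝ᵥ (effOp K (matE b Q) a *ᵥ flatE b ψ)).re := by
  rw [← blockSpin_flatE b Q (Sf := qform K) (fun φ => (hS φ).symm) ψ]
  exact blockSpin_eq_effOp hK (mulVec_matE_surjective b hQ) (ker_flatE b Q hS hcoer) ha (flatE b ψ)

/-- the E-valued effective operator is Hermitian. [folklore] -/
theorem effE_isHermitian (b : OrthonormalBasis κ ℂ E) {Q : (ι → E) →ₗ[ℂ] (ι' → E)} (hQ : Function.Surjective Q)
    {K : Matrix (ι × κ) (ι × κ) ℂ} (hK : K.PosSemidef) {S : (ι → E) → ℝ} (hS : ∀ φ, S φ = qform K (flatE b φ)) {C₁ C₂ : ℝ}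
    (hcoer : ∀ φ : ι → E, ∑ i, ‖φ i‖ ^ 2 ≤ C₁ * ∑ i', ‖Q φ i'‖ ^ 2 + C₂ * S φ) {a : ℝ} (ha : 0 < a) :
    (effOp K (matE b Q) a).IsHermitian :=
  effOp_isHermitian hK (mulVec_matE_surjective b hQ) (ker_flatE b Q hS hcoer) ha

end Mat

/-! ## §4 The tower: row NE2's wall shape and η-rate currency for an `E`-valued block-spin species, modulo its brackets -/

section Tower

variable {κ : Type*} [Fintype κ] [DecidableEq κ]
variable {ιu : Type*} [Fintype ιu] [DecidableEq ιu] {ιk : ℕ → Type*} [∀ k, Fintype (ιk k)] [∀ k, DecidableEq (ιk k)]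

/-- **ROW NE2's WALL SHAPE FOR AN E-VALUED BLOCK-SPIN SPECIES, MODULO THE PER-LEVEL BRACKETS**: a tower `(Q_k, S_k)` of ℂ-linear onto constraints
onto the fixed unit index `ιu → E` and PSD-matrix forms `S_k = qform K_k ∘ flatE b`, coercive in leaf P's shape at every level, whose consecutive
block-spin values obey the two one-sided additive brackets with defects `e_k, e′_k` ⟹
`OneStepAveragedLaw (fun _ ↦ 1) 1 (k ↦ effOp (K k) (matE b (Q k)) a) (k ↦ max e_k e′_k)` on `ιu × κ`. [folklore] -/
theorem oneStepAveragedLaw_effE (b : OrthonormalBasis κ ℂ E) (Q : ∀ k, (ιk k → E) →ₗ[ℂ] (ιu → E))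
    (K : ∀ k, Matrix (ιk k × κ) (ιk k × κ) ℂ) (S : ∀ k, (ιk k → E) → ℝ) (hQ : ∀ k, Function.Surjective (Q k))
    (hK : ∀ k, (K k).PosSemidef) (hS : ∀ k φ, S k φ = qform (K k) (flatE b φ)) {C₁ C₂ : ℕ → ℝ}
    (hcoer : ∀ k (φ : ιk k → E), ∑ i, ‖φ i‖ ^ 2 ≤ C₁ k * ∑ i', ‖Q k φ i'‖ ^ 2 + C₂ k * S k φ)
    {a : ℝ} (ha : 0 < a) (e e' : ℕ → ℝ) (he : ∀ k, 0 ≤ e k)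
    (hbr : ∀ k (ψ : ιu → E), blockSpin (Q k) (S k) ψ ≤ blockSpin (Q (k + 1)) (S (k + 1)) ψ + e k * ∑ i, ‖ψ i‖ ^ 2 ∧
      blockSpin (Q (k + 1)) (S (k + 1)) ψ ≤ blockSpin (Q k) (S k) ψ + e' k * ∑ i, ‖ψ i‖ ^ 2) :
    OneStepAveragedLaw (ι := fun _ => ιu × κ) (fun _ => (1 : Matrix (ιu × κ) (ιu × κ) ℂ)) 1
      (fun k => effOp (K k) (matE b (Q k)) a) (fun k => max (e k) (e' k)) := by
  refine oneStepAveragedLaw_effOp K (fun k => matE b (Q k)) hK (fun k => mulVec_matE_surjective b (hQ k))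
    (fun k => ker_flatE b (Q k) (hS k) (hcoer k)) ha e e' he fun k μ => ?_
  have h1 : ∀ k, blockSpin (matE b (Q k)).mulVec (qform (K k)) μ = blockSpin (Q k) (S k) (unflatE b μ) := fun k => by
    rw [← blockSpin_flatE b (Q k) (Sf := qform (K k)) (fun φ => (hS k φ).symm) (unflatE b μ), flatE_unflatE]
  have h2 : nsq μ = ∑ i, ‖unflatE b μ i‖ ^ 2 := by rw [← nsq_flatE b, flatE_unflatE]
  rw [h1 k, h1 (k + 1), h2]
  exact hbr k (unflatE b μ)

/-- **… AND THE SPINE's η-RATE CURRENCY**: GEOMETRIC per-level brackets (`e_k, e′_k ≤ C·ρ^k`, `ρ < 1`) give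
`TowerLimitRate (fun _ ↦ 1) 1 (k ↦ effOp (K k) (matE b (Q k)) a) C ρ` — the E-valued effective operators CONVERGE on the unit index `ιu × κ` with
`‖X_k − X_∞‖ ≤ C·ρ^k/(1 − ρ)`, MODULO the brackets (no leaf of any sector is proved here). [folklore] -/
theorem towerLimitRate_effE (b : OrthonormalBasis κ ℂ E) (Q : ∀ k, (ιk k → E) →ₗ[ℂ] (ιu → E))
    (K : ∀ k, Matrix (ιk k × κ) (ιk k × κ) ℂ) (S : ∀ k, (ιk k → E) → ℝ) (hQ : ∀ k, Function.Surjective (Q k))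
    (hK : ∀ k, (K k).PosSemidef) (hS : ∀ k φ, S k φ = qform (K k) (flatE b φ)) {C₁ C₂ : ℕ → ℝ}
    (hcoer : ∀ k (φ : ιk k → E), ∑ i, ‖φ i‖ ^ 2 ≤ C₁ k * ∑ i', ‖Q k φ i'‖ ^ 2 + C₂ k * S k φ)
    {a : ℝ} (ha : 0 < a) {C ρ : ℝ} (hC : 0 ≤ C) (hρ : 0 ≤ ρ) (hρ1 : ρ < 1) (e e' : ℕ → ℝ) (he : ∀ k, e k ≤ C * ρ ^ k)
    (he' : ∀ k, e' k ≤ C * ρ ^ k)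
    (hbr : ∀ k (ψ : ιu → E), blockSpin (Q k) (S k) ψ ≤ blockSpin (Q (k + 1)) (S (k + 1)) ψ + e k * ∑ i, ‖ψ i‖ ^ 2 ∧
      blockSpin (Q (k + 1)) (S (k + 1)) ψ ≤ blockSpin (Q k) (S k) ψ + e' k * ∑ i, ‖ψ i‖ ^ 2) :
    TowerLimitRate (ι := fun _ => ιu × κ) (fun _ => (1 : Matrix (ιu × κ) (ιu × κ) ℂ)) 1
      (fun k => effOp (K k) (matE b (Q k)) a) C ρ := by
  have hbr' : ∀ k (ψ : ιu → E), blockSpin (Q k) (S k) ψ ≤ blockSpin (Q (k + 1)) (S (k + 1)) ψ + C * ρ ^ k * ∑ i, ‖ψ i‖ ^ 2 ∧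
      blockSpin (Q (k + 1)) (S (k + 1)) ψ ≤ blockSpin (Q k) (S k) ψ + C * ρ ^ k * ∑ i, ‖ψ i‖ ^ 2 := fun k ψ => by
    have h := hbr k ψ
    have hn : 0 ≤ ∑ i, ‖ψ i‖ ^ 2 := sum_nonneg fun _ _ => by positivity
    exact ⟨h.1.trans (by nlinarith [he k]), h.2.trans (by nlinarith [he' k])⟩
  have hlaw := oneStepAveragedLaw_effE b Q K S hQ hK hS hcoer ha (fun k => C * ρ ^ k) (fun k => C * ρ ^ k)
    (fun k => by positivity) hbr'
  simp only [max_self] at hlaw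
  refine towerLimitRate_of_oneStepAveragedLaw _ one_pos (fun k => ?_) _ hρ1 hlaw
  rw [inv_one]
  calc ‖(1 : Matrix (ιu × κ) (ιu × κ) ℂ)‖ ^ 2 ≤ (1 : ℝ) ^ 2 :=
        pow_le_pow_left₀ (norm_nonneg _) (opNorm_one_le (ι := fun _ => ιu × κ) k) 2
    _ = 1 := one_pow 2

end Tower

end Summit.QuantumFields.BalabanUV.T4Continuum.VariationalEffectiveHilbert

end
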